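import Literature.Computability.AlgebraicComplexity.AndrewsForbes2022PfaffianReductionWeights
import Literature.Computability.AlgebraicComplexity.BideterminantReductionGauss

/-!
# Andrews–Forbes 2022, Prop. 4.2 (Pfaffian reduction) — support file 2: skew Gauss elimination

Matrix toolkit (definitions with bodies + proved lemmas, no named facts) for the proof of
`AndrewsForbes2022_prop_4_2`: the standard alternating block form `dtilde n δ = ⊕_i ((0, δ_i), (-δ_i, 0))`,
its leading principal Pfaffians `∏_{i<k} δ_i`, the rank-`2k` test matrices, and **skew Gauss
elimination**: an alternating matrix over a field all of whose leading principal Pfaffians are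
nonzero is congruent, by a LOWER UNITRIANGULAR matrix, to a standard block form
(`exists_lower_congr_eq_dtilde`) — the replacement, for the congruence action `X ↦ A X Aᵀ`, of the
`LDU` decomposition used by the tree's proof of Prop. 3.5 (`BideterminantReductionGauss.lean`).

## References
* [AndrewsForbes2022] R. Andrews, M. A. Forbes, arXiv:2112.00792, §4.1 (Prop. 4.2; "`Pf_k(D X Dᵀ)
  = Pf(D_{[k],[k]} X_{[k],[k]} Dᵀ_{[k],[k]})`", p0026:L40) — the statement served.
-/

noncomputable section

namespace Literature.Computability.AlgebraicComplexity

namespace PfaffianReduction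

open Matrix AndrewsForbes

variable {R : Type*} [CommRing R]

/-! ### The standard weighted block form -/

/-- The **standard alternating block form** `dtilde m δ = ⊕_i ((0, δ_i), (-δ_i, 0))` on `Fin m`:
entries `(2i, 2i+1) ↦ δ_i`, `(2i+1, 2i) ↦ -δ_i`, all others `0` (weights indexed by `ℕ`; only
`δ_i`, `2i + 1 < m`, matter). [cite: AndrewsForbes2022, Prop. 4.2 (proof)] -/
def dtilde (m : ℕ) (δ : ℕ → R) : Matrix (Fin m) (Fin m) R :=
  Matrix.of fun i j =>
    if (j : ℕ) = i + 1 ∧ (i : ℕ) % 2 = 0 then δ (i / 2)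
    else if (i : ℕ) = j + 1 ∧ (j : ℕ) % 2 = 0 then -δ (j / 2) else 0

/-- Unfolding `dtilde`. (proof plumbing) [cite: AndrewsForbes2022, Prop. 4.2 (proof)] -/
theorem dtilde_apply (m : ℕ) (δ : ℕ → R) (i j : Fin m) :
    dtilde m δ i j =
      if (j : ℕ) = i + 1 ∧ (i : ℕ) % 2 = 0 then δ (i / 2)
      else if (i : ℕ) = j + 1 ∧ (j : ℕ) % 2 = 0 then -δ (j / 2) else 0 := rfl

/-- `dtilde` is skew-symmetric. (proof plumbing) [cite: AndrewsForbes2022, Prop. 4.2 (proof)] -/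
theorem dtilde_transpose (m : ℕ) (δ : ℕ → R) : (dtilde m δ)ᵀ = -dtilde m δ := by
  ext i j
  simp only [transpose_apply, dtilde_apply, Matrix.neg_apply]
  by_cases h1 : (i : ℕ) = j + 1 ∧ (j : ℕ) % 2 = 0
  · have h2 : ¬ ((j : ℕ) = i + 1 ∧ (i : ℕ) % 2 = 0) := by omega
    rw [if_pos h1, if_neg h2, if_pos h1, neg_neg]
  · rw [if_neg h1]
    by_cases h2 : (j : ℕ) = i + 1 ∧ (i : ℕ) % 2 = 0
    · rw [if_pos h2, if_pos h2]
    · rw [if_neg h2, if_neg h1, if_neg h2, neg_zero]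

/-- `dtilde` has zero diagonal. (proof plumbing) [cite: AndrewsForbes2022, Prop. 4.2 (proof)] -/
theorem dtilde_apply_self (m : ℕ) (δ : ℕ → R) (i : Fin m) : dtilde m δ i i = 0 := by
  rw [dtilde_apply, if_neg (by omega), if_neg (by omega)]

/-- Leading corners of `dtilde` are `dtilde`. (proof plumbing) [cite: AndrewsForbes2022, Prop. 4.2 (proof)] -/
theorem dtilde_submatrix_castLE {m m' : ℕ} (h : m' ≤ m) (δ : ℕ → R) :
    (dtilde m δ).submatrix (Fin.castLE h) (Fin.castLE h) = dtilde m' δ := by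
  ext i j
  simp only [submatrix_apply, dtilde_apply, Fin.val_castLE]

/-- Deleting the first two rows and columns of `dtilde (m+2)` leaves `dtilde m` of the shifted
weights. (proof plumbing) [cite: AndrewsForbes2022, Prop. 4.2 (proof)] -/
theorem dtilde_submatrix_succ_succ (m : ℕ) (δ : ℕ → R) :
    (dtilde (m + 2) δ).submatrix (fun i : Fin m => i.succ.succ) (fun i : Fin m => i.succ.succ) =
      dtilde m (fun i => δ (i + 1)) := by
  ext i j
  simp only [submatrix_apply, dtilde_apply, Fin.val_succ]
  by_cases h1 : (j : ℕ) = i + 1 ∧ (i : ℕ) % 2 = 0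
  · have h1' : (j : ℕ) + 1 + 1 = (i : ℕ) + 1 + 1 + 1 ∧ ((i : ℕ) + 1 + 1) % 2 = 0 := by omega
    rw [if_pos h1', if_pos h1]
    congr 1; omega
  · have h1' : ¬ ((j : ℕ) + 1 + 1 = (i : ℕ) + 1 + 1 + 1 ∧ ((i : ℕ) + 1 + 1) % 2 = 0) := by omega
    rw [if_neg h1', if_neg h1]
    by_cases h2 : (i : ℕ) = j + 1 ∧ (j : ℕ) % 2 = 0
    · have h2' : (i : ℕ) + 1 + 1 = (j : ℕ) + 1 + 1 + 1 ∧ ((j : ℕ) + 1 + 1) % 2 = 0 := by omega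
      rw [if_pos h2', if_pos h2]
      congr 2; omega
    · have h2' : ¬ ((i : ℕ) + 1 + 1 = (j : ℕ) + 1 + 1 + 1 ∧ ((j : ℕ) + 1 + 1) % 2 = 0) := by omega
      rw [if_neg h2', if_neg h2]

/-- **`Pf(dtilde (2k) δ) = ∏_{i<k} δ_i`** (expansion along the first row: only the entry
`(0,1) = δ_0` survives). [cite: AndrewsForbes2022, Prop. 4.2 (proof, p0026:L40)] -/
theorem pfaffian_dtilde : ∀ (k : ℕ) (δ : ℕ → R),
    pfaffian (2 * k) (dtilde (2 * k) δ) = ∏ i ∈ Finset.range k, δ i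
  | 0, δ => by simp
  | k + 1, δ => by
    show pfaffian (2 * k + 2) (dtilde (2 * k + 2) δ) = _
    rw [pfaffian, Fin.sum_univ_succ, Finset.sum_eq_zero, add_zero, Finset.prod_range_succ']
    · have h01 : dtilde (2 * k + 2) δ 0 (Fin.succ 0) = δ 0 := by
        rw [dtilde_apply, if_pos (by simp)]
        simp
      simp only [Fin.val_zero, pow_zero, one_mul, h01, Fin.succAbove_zero]
      rw [dtilde_submatrix_succ_succ (2 * k) δ, pfaffian_dtilde k, mul_comm]
    · intro j _
      have : dtilde (2 * k + 2) δ 0 j.succ.succ = 0 := by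
        rw [dtilde_apply, if_neg, if_neg] <;> simp [Fin.val_succ]
      rw [this, mul_zero, zero_mul]

/-! ### The rank-`2k` test matrices -/

/-- The test weights `(1, …, 1, 0, …)` (`k` ones): `dtilde m (indWt k)` is the standard alternating
matrix of rank `2k`. [cite: AndrewsForbes2022, Prop. 4.2 (proof)] -/
def indWt (k : ℕ) : ℕ → R := fun i => if i < k then 1 else 0

/-- Leading principal Pfaffians of the test matrix: `1` up to size `2k`, `0` beyond.
[cite: AndrewsForbes2022, Prop. 4.2 (proof)] -/
theorem pfaffian_dtilde_indWt_corner {m : ℕ} (j k : ℕ) (h : 2 * j ≤ m) :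
    pfaffian (2 * j) ((dtilde m (indWt (R := R) k)).submatrix (Fin.castLE h) (Fin.castLE h)) =
      if j ≤ k then 1 else 0 := by
  rw [dtilde_submatrix_castLE h, pfaffian_dtilde]
  split_ifs with hjk
  · exact Finset.prod_eq_one fun i hi => by
      simp only [indWt, if_pos (lt_of_lt_of_le (Finset.mem_range.mp hi) hjk)]
  · exact Finset.prod_eq_zero (Finset.mem_range.mpr (not_le.mp hjk)) (by simp [indWt])

/-- The inclusion `𝔽^{m'} → 𝔽^m` of the first `m'` coordinates, as a matrix. [folklore] -/
def inclMat (m m' : ℕ) (h : m' ≤ m) : Matrix (Fin m) (Fin m') R :=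
  Matrix.of fun i a => if i = Fin.castLE h a then 1 else 0

/-- The test matrix of rank `2k` factors through `𝔽^{2k}` (its rows `≥ 2k` vanish).
[cite: AndrewsForbes2022, Prop. 4.2 (proof)] -/
theorem dtilde_indWt_eq_inclMat_mul {m k : ℕ} (h : 2 * k ≤ m) :
    dtilde m (indWt (R := R) k) =
      (inclMat m (2 * k) h : Matrix (Fin m) (Fin (2 * k)) R) *
        (dtilde m (indWt (R := R) k)).submatrix (Fin.castLE h) id := by
  ext i j
  rw [Matrix.mul_apply]
  simp only [inclMat, Matrix.of_apply, submatrix_apply, id_eq, ite_mul, one_mul, zero_mul]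
  by_cases hi : (i : ℕ) < 2 * k
  · rw [Finset.sum_eq_single ⟨i, hi⟩]
    · simp
    · intro a _ ha
      rw [if_neg]
      intro hia
      apply ha
      ext; simp [hia]
    · intro hh; exact absurd (Finset.mem_univ _) hh
  · rw [Finset.sum_eq_zero]
    · rw [dtilde_apply]
      split_ifs with h1 h2
      · rw [indWt, if_neg (by omega)]
      · rw [indWt, if_neg (by omega), neg_zero]
      · rfl
    · intro a _
      rw [if_neg]
      intro hia
      apply hi
      rw [hia]; exact a.2

/-- **Congruence images of the rank-`2k` test matrix into size `r' > 2k` are singular.**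
[cite: AndrewsForbes2022, Prop. 4.2 (proof)] -/
theorem det_congr_dtilde_indWt_eq_zero {K : Type*} [Field K] {m k r' : ℕ} (h : 2 * k ≤ m)
    (hr : 2 * k < r') (B : Matrix (Fin r') (Fin m) K) :
    (B * dtilde m (indWt (R := K) k) * Bᵀ).det = 0 := by
  rw [dtilde_indWt_eq_inclMat_mul h, ← Matrix.mul_assoc, Matrix.mul_assoc (B * inclMat m (2 * k) h)]
  exact det_mul_eq_zero_of_lt hr _ _

/-! ### Skew Gauss elimination -/

section SkewGauss

variable {K : Type*} [Field K]

/-- Blocks of an alternating matrix in block form are constrained: `Aᵀ = -A`, `Cᵀ = -B`, `Dᵀ = -D`.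
[folklore] -/
private theorem fromBlocks_alt {p q : Type*} {A : Matrix p p K} {B : Matrix p q K} {C : Matrix q p K}
    {D : Matrix q q K} (h : (fromBlocks A B C D)ᵀ = -fromBlocks A B C D) :
    Aᵀ = -A ∧ Cᵀ = -B ∧ Bᵀ = -C ∧ Dᵀ = -D := by
  rw [fromBlocks_transpose, fromBlocks_neg] at h
  exact fromBlocks_inj.mp h

/-- **Skew Gauss elimination.** An alternating `2n × 2n` matrix over a field all of whose leading
principal Pfaffians `Pf(Z_{[2k]})` are nonzero is congruent by a lower unitriangular matrix to a
standard block form: `L · Z · Lᵀ = dtilde (2n) δ`. Proof by induction on `n`, peeling off the last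
two rows and columns with the Schur complement of the (invertible: `det = Pf² ≠ 0`) leading block;
the cleared top-right block vanishes because a congruence of an alternating matrix is alternating.
[cite: AndrewsForbes2022, Prop. 4.2 (proof)] -/
theorem exists_lower_congr_eq_dtilde : ∀ (n : ℕ) (Z : Matrix (Fin (2 * n)) (Fin (2 * n)) K),
    Zᵀ = -Z → (∀ i, Z i i = 0) →
    (∀ k (hk : 2 * k ≤ 2 * n), pfaffian (2 * k) (Z.submatrix (Fin.castLE hk) (Fin.castLE hk)) ≠ 0) →
    ∃ (L : Matrix (Fin (2 * n)) (Fin (2 * n)) K) (δ : ℕ → K),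
      L.BlockTriangular OrderDual.toDual ∧ (∀ i, L i i = 1) ∧ L * Z * Lᵀ = dtilde (2 * n) δ
  | 0, Z, _, _, _ => ⟨1, fun _ => 0, blockTriangular_one, fun i => i.elim0, by ext i; exact i.elim0⟩
  | n + 1, Z, hZt, hZd, hZ => by
    have h2n : 2 * n ≤ 2 * (n + 1) := by omega
    -- the leading `2n × 2n` block and the induction hypothesis
    set Z' : Matrix (Fin (2 * n)) (Fin (2 * n)) K := Z.submatrix (Fin.castLE h2n) (Fin.castLE h2n)
      with hZ'def
    have hcast : ∀ k (hk : 2 * k ≤ 2 * n),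
        (Fin.castLE h2n ∘ Fin.castLE hk : Fin (2 * k) → Fin (2 * (n + 1))) = Fin.castLE (hk.trans h2n) :=
      fun k hk => funext fun i => Fin.ext rfl
    have hZ' : ∀ k (hk : 2 * k ≤ 2 * n),
        pfaffian (2 * k) (Z'.submatrix (Fin.castLE hk) (Fin.castLE hk)) ≠ 0 := by
      intro k hk
      have h := hZ k (hk.trans h2n)
      rwa [hZ'def, submatrix_submatrix, hcast k hk]
    have hZ't : Z'ᵀ = -Z' := by
      rw [hZ'def, transpose_submatrix, hZt, submatrix_neg, Pi.neg_apply, Pi.neg_apply]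
    have hZ'd : ∀ i, Z' i i = 0 := fun i => hZd _
    obtain ⟨L', δ', hL't, hL'd, hLZL'⟩ := exists_lower_congr_eq_dtilde n Z' hZ't hZ'd hZ'
    have hdetZ' : Z'.det ≠ 0 := by
      have h := hZ' n le_rfl
      have hid : (Fin.castLE (le_refl (2 * n)) : Fin (2 * n) → Fin (2 * n)) = id := funext fun i => Fin.ext rfl
      rw [hid, submatrix_id_id, pfaffian_eq_matrixPfaffian] at h
      rw [Literature.LinearAlgebra.Matrix.det_eq_pfaffian_sq Z' hZ't hZ'd]
      exact pow_ne_zero 2 h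
    letI : Invertible Z' := invertibleOfIsUnitDet Z' (Ne.isUnit hdetZ')
    -- block form of `Z`
    let e : Fin (2 * n) ⊕ Fin 2 ≃ Fin (2 * n + 2) := finSumFinEquiv
    let B : Matrix (Fin (2 * n)) (Fin 2) K := Z.submatrix (Fin.castLE h2n) (fun a => Fin.natAdd (2 * n) a)
    let C : Matrix (Fin 2) (Fin (2 * n)) K := Z.submatrix (fun a => Fin.natAdd (2 * n) a) (Fin.castLE h2n)
    let D : Matrix (Fin 2) (Fin 2) K := Z.submatrix (fun a => Fin.natAdd (2 * n) a) (fun a => Fin.natAdd (2 * n) a)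
    have he_inl : ∀ i : Fin (2 * n), e (Sum.inl i) = Fin.castLE h2n i := fun i => Fin.ext rfl
    have he_inr : ∀ a : Fin 2, e (Sum.inr a) = Fin.natAdd (2 * n) a := fun a => rfl
    have hblocks : Z.submatrix e e = fromBlocks Z' B C D := by
      ext (i | i) (j | j) <;>
        simp only [submatrix_apply, he_inl, he_inr, fromBlocks_apply₁₁, fromBlocks_apply₁₂,
          fromBlocks_apply₂₁, fromBlocks_apply₂₂, hZ'def, B, C, D]
    have hZbt : (fromBlocks Z' B C D)ᵀ = -fromBlocks Z' B C D := by
      rw [← hblocks, transpose_submatrix, hZt, submatrix_neg, Pi.neg_apply, Pi.neg_apply]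
    obtain ⟨-, hCt, hBt, hDt⟩ := fromBlocks_alt hZbt
    -- Schur complement step: clear the last two rows, then the last two columns follow by skewness
    let E : Matrix (Fin 2) (Fin (2 * n)) K := -(C * ⅟Z')
    let P : Matrix (Fin (2 * n) ⊕ Fin 2) (Fin (2 * n) ⊕ Fin 2) K := fromBlocks 1 0 E 1
    let S₀ : Matrix (Fin 2) (Fin 2) K := E * B + D
    have hPt : Pᵀ = fromBlocks 1 Eᵀ 0 1 := by
      simp only [P, fromBlocks_transpose, transpose_one, transpose_zero]
    have hPZP₀ : P * fromBlocks Z' B C D * Pᵀ = fromBlocks Z' (Z' * Eᵀ + B) 0 S₀ := by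
      rw [hPt]
      simp only [P, S₀, E, fromBlocks_multiply, Matrix.mul_zero, Matrix.zero_mul, Matrix.one_mul,
        Matrix.mul_one, add_zero, zero_add, Matrix.neg_mul, Matrix.invOf_mul_cancel_right,
        neg_add_cancel]
    have halt : (P * fromBlocks Z' B C D * Pᵀ)ᵀ = -(P * fromBlocks Z' B C D * Pᵀ) :=
      transpose_mul_mul_transpose_of_alt P _ hZbt
    have hTR : Z' * Eᵀ + B = 0 := by
      rw [hPZP₀] at halt
      obtain ⟨-, h0, -, -⟩ := fromBlocks_alt halt
      rw [transpose_zero] at h0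
      exact neg_eq_zero.mp h0.symm
    have hPZP : P * fromBlocks Z' B C D * Pᵀ = fromBlocks Z' 0 0 S₀ := by rw [hPZP₀, hTR]
    -- `S₀` is alternating, hence a `dtilde` block
    have hS₀t : S₀ᵀ = -S₀ := by
      rw [hPZP] at halt
      exact (fromBlocks_alt halt).2.2.2
    have hS₀d : ∀ a, S₀ a a = 0 := by
      intro a
      have hd : ∀ i, fromBlocks Z' B C D i i = 0 := by
        rintro (i | i)
        · simp [hZ'd]
        · simp only [fromBlocks_apply₂₂, D, submatrix_apply]; exact hZd _
      have := mul_mul_transpose_apply_self_of_alt P _ hZbt hd (Sum.inr a)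
      rwa [hPZP, fromBlocks_apply₂₂] at this
    -- the induction hypothesis on the leading block, and the total congruence
    let EL : Matrix (Fin (2 * n) ⊕ Fin 2) (Fin (2 * n) ⊕ Fin 2) K := fromBlocks L' 0 0 1
    let δ : ℕ → K := fun i => if i < n then δ' i else S₀ 0 1
    have hS₀ : S₀ = dtilde 2 (fun _ => S₀ 0 1) := by
      ext a b
      rw [dtilde_apply]
      fin_cases a <;> fin_cases b
      · simpa using hS₀d 0
      · simp
      · have := congrFun (congrFun hS₀t 0) 1
        simp only [transpose_apply, Matrix.neg_apply] at this
        simpa using this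
      · simpa using hS₀d 1
    have hdt' : dtilde (2 * n) δ' = dtilde (2 * n) δ := by
      ext i j
      simp only [dtilde_apply, δ]
      split_ifs <;> first | rfl | omega
    have hdt2 : dtilde 2 (fun _ => S₀ 0 1) = dtilde 2 (fun i => δ (i + n)) := by
      ext a b
      simp only [dtilde_apply, δ]
      split_ifs <;> first | rfl | omega
    have hblockδ : fromBlocks (dtilde (2 * n) δ) 0 0 (dtilde 2 (fun i => δ (i + n))) =
        (dtilde (2 * n + 2) δ).submatrix e e := by
      ext (i | i) (j | j)
      · simp only [fromBlocks_apply₁₁, submatrix_apply, he_inl, dtilde_apply, Fin.val_castLE]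
      · simp only [fromBlocks_apply₁₂, Matrix.zero_apply, submatrix_apply, he_inl, he_inr, dtilde_apply,
          Fin.val_castLE, Fin.val_natAdd]
        rw [if_neg (by omega), if_neg (by omega)]
      · simp only [fromBlocks_apply₂₁, Matrix.zero_apply, submatrix_apply, he_inl, he_inr, dtilde_apply,
          Fin.val_castLE, Fin.val_natAdd]
        rw [if_neg (by omega), if_neg (by omega)]
      · simp only [fromBlocks_apply₂₂, submatrix_apply, he_inr, dtilde_apply, Fin.val_natAdd]
        have h1 : ((j : ℕ) = i + 1 ∧ (i : ℕ) % 2 = 0) ↔ (2 * n + (j : ℕ) = 2 * n + i + 1 ∧ (2 * n + (i : ℕ)) % 2 = 0) := by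
          omega
        have h2 : ((i : ℕ) = j + 1 ∧ (j : ℕ) % 2 = 0) ↔ (2 * n + (i : ℕ) = 2 * n + j + 1 ∧ (2 * n + (j : ℕ)) % 2 = 0) := by
          omega
        simp only [h1, h2]
        split_ifs with h3 h4
        · congr 1; omega
        · congr 2; omega
        · rfl
    have hE : EL * fromBlocks Z' 0 0 S₀ * ELᵀ = (dtilde (2 * n + 2) δ).submatrix e e := by
      have h1 : EL * fromBlocks Z' 0 0 S₀ * ELᵀ = fromBlocks (L' * Z' * L'ᵀ) 0 0 S₀ := by
        simp only [EL, fromBlocks_transpose, transpose_one, transpose_zero, fromBlocks_multiply,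
          Matrix.mul_zero, Matrix.zero_mul, Matrix.one_mul, Matrix.mul_one, add_zero, zero_add]
      rw [h1, hLZL', hdt', hS₀, hdt2, hblockδ]
    have hELP : EL * P = fromBlocks L' 0 E 1 := by
      simp only [EL, P, fromBlocks_multiply, Matrix.mul_zero, Matrix.zero_mul, Matrix.one_mul,
        Matrix.mul_one, add_zero, zero_add]
    have htotal : (EL * P) * Z.submatrix e e * (EL * P)ᵀ = (dtilde (2 * n + 2) δ).submatrix e e := by
      rw [hblocks, ← hE, ← hPZP, transpose_mul]
      simp only [Matrix.mul_assoc]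
    have hval_inl : ∀ i : Fin (2 * n), ((e (Sum.inl i) : Fin (2 * n + 2)) : ℕ) = i := fun i => rfl
    have hval_inr : ∀ a : Fin 2, ((e (Sum.inr a) : Fin (2 * n + 2)) : ℕ) = 2 * n + a := fun a => rfl
    refine ⟨(EL * P).submatrix e.symm e.symm, δ, ?_, ?_, ?_⟩
    · -- lower triangular
      intro i j hij
      obtain ⟨x, rfl⟩ := e.surjective i
      obtain ⟨y, rfl⟩ := e.surjective j
      have hlt : ((e x : Fin (2 * n + 2)) : ℕ) < ((e y : Fin (2 * n + 2)) : ℕ) :=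
        Fin.lt_def.mp (OrderDual.toDual_lt_toDual.mp hij)
      simp only [submatrix_apply, Equiv.symm_apply_apply, hELP]
      rcases x with x | x <;> rcases y with y | y
      · simp only [fromBlocks_apply₁₁]
        rw [hval_inl, hval_inl] at hlt
        exact hL't (show OrderDual.toDual y < OrderDual.toDual x from Fin.lt_def.mpr hlt)
      · simp only [fromBlocks_apply₁₂, Matrix.zero_apply]
      · rw [hval_inr, hval_inl] at hlt
        have := y.2
        omega
      · simp only [fromBlocks_apply₂₂]
        rw [hval_inr, hval_inr] at hlt
        rw [Matrix.one_apply_ne]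
        intro hxy; rw [hxy] at hlt; exact lt_irrefl _ hlt
    · -- unit diagonal
      intro i
      obtain ⟨x, rfl⟩ := e.surjective i
      simp only [submatrix_apply, Equiv.symm_apply_apply, hELP]
      rcases x with x | x
      · simp only [fromBlocks_apply₁₁, hL'd]
      · simp only [fromBlocks_apply₂₂, Matrix.one_apply_eq]
    · -- the congruence
      have hZe : Z = (Z.submatrix e e).submatrix e.symm e.symm := by
        simp only [submatrix_submatrix, Equiv.self_comp_symm, submatrix_id_id]
      conv_lhs => rw [hZe]
      rw [transpose_submatrix, submatrix_mul_equiv, submatrix_mul_equiv, htotal]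
      change _ = (dtilde (2 * n + 2) δ)
      simp only [submatrix_submatrix, Equiv.self_comp_symm, submatrix_id_id]

end SkewGauss

end PfaffianReduction

end Literature.Computability.AlgebraicComplexity
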